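import Summits.BirchSwinnertonDyer.Rank1Residual.Additive.ChiBranchRatLowerDvdUnitRows
import Summits.BirchSwinnertonDyer.Rank1Residual.Additive.ChiBranchRatLowerDvdMult
import HarnessLib

/-!
# Unit-row discharge, (M) EVEN branch (`p ≡ 1 (mod 4)`): on the UNIT rows the one-sided node
# `ChiBranchRatLowerDvdMultAt` — hence the rational branch main conjecture `ChiBranchRatCharEqMultAt`
# of the multiplicative twist — is a THEOREM from Kato's printed half alone
# (cell `b2b-bsdres`, team n1011, seat n1011-p06 gen 2, OWNERS row T-N10R, phase 4, unit rows, (M) even)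

HONEST FRAMING (cell `b2b-bsdres`, run/shared/lean/b2b/bsd-rank1-residual/, verbatim in every
file): the goal of the cell is to DELETE the COMBINATION-SHAPED residual classes of the
Birch–Swinnerton-Dyer formula for ALL analytic-rank `≤ 1` elliptic curves over `ℚ` — "full BSD
formula for every rank `≤ 1` curve in class `C`" assembled STRICTLY from published theorems — so
that the rank-`≤ 1` remainder becomes exactly the CONSTRUCTION-SHAPED classes, which are TYPED
(missing-input `Prop`s), NOT attempted. This is not "finishing BSD". Team n1011 (X4 ∧ `p = 3` / the
additive block, §I items N10 / N11): research routes; prove what is provable now; no claim beyond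
the stated classes; X4(M) stays CONSTRUCTION-SHAPED; labels / census / located gap UNCHANGED;
nothing is booked. Theorems only (no definition, no named fact minted; the Literature input is the
explicit binder `hKato` = the Kato/Wuthrich half-eigenspace reading).

## What and why

(M)-even twin of `ChiBranchRatLowerDvdUnitRows.lean` §2 and `ChiBranchRatLowerDvdUnitRowsEven.lean`
(same seat): on a UNIT row (`L(E,1) = q·Ω_E`, `ord_p q = 0`) at `p ≡ 1 (mod 4)`, `E` potentially
multiplicative at `p`, the constant term of the Néron-normalised even branch
`ϖ · L_p⁺(f♭, a_p, ω^{(p−1)/2}, T)` of the MULTIPLICATIVE twist is `ϖ·a_p⁻¹·∑(a/p)[a/p]⁺_f`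
(`constantCoeff_padicLFunctionPlusBranchMult_half`, `a_p = ±1`) with `ϖ·∑(…) = L(E,1)/Ω_E = q`
(`entireLFunction_one_eq_of_twist_pos`: even Birch formula + Gauss + Pal, PROVED, sign pinned), so
Kato's element `g₁ ∈ char_Λ X(E/ℚ_∞)` with `ι g₁ = u·ϖ L_p⁺` is a unit of `Λ`, `char_Λ X = Λ`, and the
node `ChiBranchRatLowerDvdMultAt W p` holds with `G = u⁻¹ g₁`, `m = n = 0`; by the split
(`chiBranchRatCharEqMultAt_of_katoHalf_of_ratLowerDvd`, p254665) the rational even-branch main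
conjecture of the multiplicative twist `ChiBranchRatCharEqMultAt W p` is then a THEOREM on the unit
rows (X4(M) ∧ surj(p): tower by n1011-p14's `ClassX4M.towerSurj_of_surj`). Nothing of T-E3d is
written. Nothing booked; no label change.

References: K. Kato, Astérisque 295 (2004) Thm. 17.4 (3) (p. 273) [Kato2004Asterisque];
Mazur–Tate–Teitelbaum, Invent. Math. 84 (1986) §I.10 (10.1), §I.13–I.14 [MazurTateTeitelbaum1986Invent];
A. Pal, Proc. AMS (2012) Thm. 3.2 [Pal2012]; C. Skinner, E. Urban, Invent. Math. 195 (2014) Thm. 3.6.4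
(p. 43) [SkinnerUrban2014]; C. Wuthrich, J. London Math. Soc. 90 (2014) Lemma 20 (p. 399) [Wuthrich2014].
-/

noncomputable section

open scoped Classical MatrixGroups ModularForm NumberField

open CongruenceSubgroup WeierstrassCurve NumberField Literature.NumberTheory.EllipticCurves
  Literature.NumberTheory.EllipticCurves.ModularForms
  Literature.NumberTheory.EllipticCurves.Rank1Residual
  Literature.NumberTheory.EllipticCurves.Rank1Residual.Typed
  Literature.NumberTheory.GaloisRepresentations
  IsDedekindDomain

namespace Summit.BirchSwinnertonDyer.Rank1Residual.Additive

variable {W : WeierstrassCurve ℚ} [W.IsElliptic] [W.IsGloballyMinimal] {p : ℕ} [hp : Fact p.Prime]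

/-- **UNIT rows, (M) even branch (`p ≡ 1 (mod 4)`): Kato's half ALONE gives the one-sided node
`ChiBranchRatLowerDvdMultAt W p`.** For `W` globally minimal, potentially multiplicative at
`p ≡ 1 (mod 4)`, `ρ̄_{W,p^n}` onto for all `n`, `L(E,1) = q·Ω_E` with `q ≠ 0`, `ord_p q = 0`: Kato's
`g₁` with `ι g₁ = u·ϖ·L_p⁺(f♭, a_p, ω^{(p−1)/2}, T)` has unit constant term —
`(ϖ L_p⁺)(0) = ϖ·a_p⁻¹·∑(a/p)[a/p]⁺_f` (`constantCoeff_padicLFunctionPlusBranchMult_half`, `a_p = ±1`)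
and `L(E,1) = ϖ·∑(…)·Ω_E` (`entireLFunction_one_eq_of_twist_pos`, sign pinned by Gauss + Pal) — so
`(u⁻¹ g₁) = Λ`. [cite: Kato2004Asterisque, Thm. 17.4 (3) (p. 273)]
[cite: MazurTateTeitelbaum1986Invent, §I.10, §I.13–I.14] [cite: Pal2012, Thm. 3.2] -/
theorem chiBranchRatLowerDvdMultAt_of_katoHalf_of_unitLValue
    (hKato : Wuthrich2014.kato_halfEigenCharIdeal_dvd_cyclotomicPrime_of_surjective)
    (hmod : hasEntireLFunction_rat) (hpm : AdditivePotMult.PotMult W p)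
    (htower : ∀ n : ℕ, W.HasSurjectiveModNGaloisRep (p ^ n : ℕ))
    {q : ℚ} (hq : W.entireLFunction 1 = (q : ℂ) * (W.realPeriodRat : ℂ)) (hq0 : q ≠ 0)
    (hv : padicValRat p q = 0) :
    ChiBranchRatLowerDvdMultAt W p := by
  intro V _ _ κ γ N _ f hp1 hCW hV hκ hγ hcv hf ap hap D ϖ hϖ g _hg
  have hp2 : p ≠ 2 := by omega
  have hpne : (p : ℚ) ≠ 0 := Nat.cast_ne_zero.mpr hp.out.ne_zero
  have hsurjV : ∀ n : ℕ, V.HasSurjectiveModNGaloisRep (p ^ n : ℕ) := fun n ↦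
    (GaloisImage.hasSurjectiveModNGaloisRep_pow_iff_of_model_twist V p hpne hCW n).mp (htower n)
  -- Kato's element
  obtain ⟨-, g₁, -, u, hιg₁⟩ :=
    exists_mem_charIdeal_map_eq_unit_mul_plusBranchMult_of_katoHalf W p hKato hpm V hp1 hCW hsurjV hκ hγ
      hcv hf hap D ϖ hϖ
  have hCu : iwasawaToPowerSeries p (PowerSeries.C ((u⁻¹ : ℤ_[p]ˣ) : ℤ_[p])) =
      PowerSeries.C ((((u⁻¹ : ℤ_[p]ˣ) : ℤ_[p]) : ℚ_[p])) := by
    rw [PowerSeries.map_C, PadicInt.algebraMap_apply]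
  have hu0 : (((u : ℤ_[p]) : ℚ_[p])) ≠ 0 := by
    intro h0
    have h1 : (((u⁻¹ : ℤ_[p]ˣ) : ℤ_[p]) : ℚ_[p]) * (((u : ℤ_[p]) : ℚ_[p])) = 1 := by
      rw [← PadicInt.coe_mul, Units.inv_mul, PadicInt.coe_one]
    rw [h0, mul_zero] at h1
    exact zero_ne_one h1
  have hιG : iwasawaToPowerSeries p (PowerSeries.C ((u⁻¹ : ℤ_[p]ˣ) : ℤ_[p]) * g₁) =
      PowerSeries.C (ϖ : ℚ_[p]) * padicLFunctionPlusBranchMult f (ap : ℚ_[p]) (p / 2) := by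
    rw [map_mul, hιg₁, hCu, ← mul_assoc, ← map_mul, coe_units_inv_eq_inv, ← mul_assoc,
      inv_mul_cancel₀ hu0, one_mul]
  -- `a_p = ±1`, `p ∣ N`
  obtain ⟨C, hC⟩ := hCW
  have hap1 : (ap = 1 ∨ ap = -1) ∧ p ∣ N := by
    by_cases hs : V.HasSplitMultiplicativeReductionAtPrime p
    · obtain ⟨h1, -⟩ := hf.cuspCoeff_eq_one_and_sq_of_split hs
      exact ⟨Or.inl (by exact_mod_cast (hap.symm.trans h1 : ((ap : ℤ) : ℂ) = 1)),
        hf.dvd_level_of_split hs⟩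
    · obtain ⟨h1, hpN⟩ := hf.cuspCoeff_eq_neg_one_and_dvd_of_nonsplit hV hs
      exact ⟨Or.inr (by exact_mod_cast (hap.symm.trans h1 : ((ap : ℤ) : ℂ) = -1)), hpN⟩
  obtain ⟨hap1, hpN⟩ := hap1
  have hap0 : (ap : ℚ_[p]) ≠ 0 := by rcases hap1 with rfl | rfl <;> norm_num
  have hapn : ‖(ap : ℚ_[p])⁻¹‖ = 1 := by rcases hap1 with rfl | rfl <;> norm_num
  -- `L(E,1) = ϖ S⁺ Ω_E` (sign pinned) and the unit row ⟹ `ord_p (ϖ S⁺) = 0`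
  have hL := entireLFunction_one_eq_of_twist_pos p hmod hp1 V W C hC (Or.inr hV) hpm.1 hf ϖ hϖ
  have hΩ : (W.realPeriodRat : ℂ) ≠ 0 := by exact_mod_cast W.realPeriodRat_pos_holds.ne'
  have hqS : ϖ * legendrePlusSymbolSum f p = q := by
    have h : ((ϖ * legendrePlusSymbolSum f p : ℚ) : ℂ) = (q : ℂ) :=
      mul_right_cancel₀ hΩ (hL.symm.trans hq)
    exact_mod_cast h
  have hϖS0 : ϖ * legendrePlusSymbolSum f p ≠ 0 := by rw [hqS]; exact hq0
  have hϖSv : padicValRat p (ϖ * legendrePlusSymbolSum f p) = 0 := by rw [hqS]; exact hv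
  have h1 : ‖PowerSeries.constantCoeff
      (PowerSeries.C (ϖ : ℚ_[p]) * padicLFunctionPlusBranchMult f (ap : ℚ_[p]) (p / 2))‖ = 1 := by
    rw [map_mul, PowerSeries.constantCoeff_C,
      constantCoeff_padicLFunctionPlusBranchMult_half p hp2 hf.1 hf.coeffField_eq_bot hpN hap hap0,
      ← mul_assoc, mul_comm (ϖ : ℚ_[p]), mul_assoc, norm_mul, hapn, one_mul, ← Rat.cast_mul]
    exact norm_ratCast_padic_eq_one_of_padicValRat_eq_zero p hϖS0 hϖSv
  refine ⟨PowerSeries.C ((u⁻¹ : ℤ_[p]ˣ) : ℤ_[p]) * g₁, 0, 0, ?_, ?_⟩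
  · rw [span_singleton_eq_top_of_map_eq_of_norm_constantCoeff_eq_one p hιG h1]
    exact Submodule.mem_top
  · rw [pow_zero, map_one, one_mul, hιG]

/-- **UNIT rows, (M) even branch: the rational `ω^{(p−1)/2}`-branch main conjecture of the
multiplicative twist `ChiBranchRatCharEqMultAt W p` is a THEOREM from Kato's half** (node + split
`chiBranchRatCharEqMultAt_of_katoHalf_of_ratLowerDvd`). [cite: Kato2004Asterisque, Thm. 17.4 (3) (p. 273)]
[cite: SkinnerUrban2014, Thm. 3.6.4, proof (p. 43)] -/
theorem chiBranchRatCharEqMultAt_of_katoHalf_of_unitLValue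
    (hKato : Wuthrich2014.kato_halfEigenCharIdeal_dvd_cyclotomicPrime_of_surjective)
    (hmod : hasEntireLFunction_rat) (hpm : AdditivePotMult.PotMult W p)
    (htower : ∀ n : ℕ, W.HasSurjectiveModNGaloisRep (p ^ n : ℕ))
    {q : ℚ} (hq : W.entireLFunction 1 = (q : ℂ) * (W.realPeriodRat : ℂ)) (hq0 : q ≠ 0)
    (hv : padicValRat p q = 0) :
    ChiBranchRatCharEqMultAt W p :=
  chiBranchRatCharEqMultAt_of_katoHalf_of_ratLowerDvd hKato hpm htower
    (chiBranchRatLowerDvdMultAt_of_katoHalf_of_unitLValue hKato hmod hpm htower hq hq0 hv)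

/-- **X4(M) ∧ surj(p), UNIT rows, `p ≡ 1 (mod 4)`: the rational even-branch main conjecture of the
multiplicative twist is a THEOREM** (tower from surj(p) by n1011-p14's `ClassX4M.towerSurj_of_surj`,
no certificate). [cite: Kato2004Asterisque, Thm. 17.4 (3) (p. 273)] [cite: Wuthrich2014, Lemma 20 (p. 399)] -/
theorem _root_.Summit.BirchSwinnertonDyer.Rank1Residual.AdditivePotMult.ClassX4M.chiBranchRatCharEqMultAt_of_unitLValue_of_surj
    (hKato : Wuthrich2014.kato_halfEigenCharIdeal_dvd_cyclotomicPrime_of_surjective)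
    (hmod : hasEntireLFunction_rat) (hX : AdditivePotMult.ClassX4M W p) (hsurj : Surj W p)
    {q : ℚ} (hq : W.entireLFunction 1 = (q : ℂ) * (W.realPeriodRat : ℂ)) (hq0 : q ≠ 0)
    (hv : padicValRat p q = 0) :
    ChiBranchRatCharEqMultAt W p :=
  chiBranchRatCharEqMultAt_of_katoHalf_of_unitLValue hKato hmod hX.potMult (hX.towerSurj_of_surj hsurj)
    hq hq0 hv

end Summit.BirchSwinnertonDyer.Rank1Residual.Additive

end
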